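/-
Copyright: the b2b-balaban cell (near-miss cell 7), T⁴-continuum fan-out; row NE7b ROUND-2 swarm, seat
t4-ne7b-formalise-leaf-05 gen 10 (row S12o «CONCAVE ENTROPY REPAIR» of `t4/b2b-balaban-t4-ne7b-p1/LEAVES-NE7b.md`, part
(ii) «THE WIRING», file 4∕4 — THE CONCAVE TWIN END; owner's ruling R-OWNER-23-15 and division of labour, journal
l.17861 ∕ l.17953 ∕ l.18163; CLAIM l.17968).  Released under the licence of the surrounding project.
-/
import Summits.QuantumFields.BalabanUV.T4Continuum.Support.HistoryJoinsPlacedLawsConcave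
import Summits.QuantumFields.BalabanUV.T4Continuum.Support.HistoryJoinsPlacedTwin

/-!
# The count's CONCAVE END for the concrete zone ON THE SORTED FLAT TWIN of a realised pedigree
# (row S12o part (ii), file 4∕4 — «THE CONCAVE TWIN END», letter `ΘJc`)

Summits-side support leaf of the T⁴-continuum cell (rung (B)+1 on a FINITE torus only; NOT infinite volume, NOT the
mass gap, NOT the Clay statement; NOT a proof of the spine estimate NE7b).  Row NE7b, route «COUNT»; smallness-census
rows S12n ∕ S12o.  SIBLING of gen 4's twin END `HistoryJoinsPlacedTwin.card_S_sortR_le_exp_pow` (p219354): the SAME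
binders and statement shape, the displayed class-linear constant replaced by the CONCAVE one — composition BY NAME of
file 3∕4's `HistoryJoinsPlacedLawsConcave.card_S_le_exp_pow_zonePΩ` (concave END for the concrete zone: part 7′'s mass
pivot (leaf-09 g9 ∕ leaf-10 g12) and leaf-10 g12's scaled, pivoted distance potential) at the counted member of route (α)
— leaf-10 gen 3's SORTED FLAT TWIN `P.sortR.gen c` — with gen 4's entropy binder `hENT_sortR` and the invariances
`bsum_gen_sortR` ∕ `partnerAges_gen_sortR` exactly as in the twin END.  [folklore] Nothing is quoted from print, nothing
printed is asserted, no `[cite:]` tag, no `Prop` fact minted, no definition, constants symbolic (c2∕c6); no landed file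
edited; no END of record ∕ exit ∕ socket ∕ `HistoryConstants*` file touched (c3).

THE LETTER `ΘJc` (for leaf-08 g11's part (iii) siblings, `htwin` at `Θ₀ := ΘJc`; symbolic in `d c s θ`, read off the
statement below): with `A₁ = (2·cth c 1 s + 1)^d`, `A = A₁·5^d`, `C₁ = (2c+1)^d`, `Cr = 4·2^d`, `WB = 2A₁·C₁·Cr`,
`WM = 4A`, `γ′ = 2A`, `ρℓ = max 1 (2c+2)`, `X = (WB+WM)∕(1−θ)`, `d₁ = 2·log(2d+1)`, `Ω = ρℓ·X + ρℓ·γ′ + 1`: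
  **`ΘJc = 1 + log(X + 2γ′) + (0 + 3d₁ + 2d + d₁·Cr + d·log(2Ω(1 + Cr) + 1)) + 10`**
against the twin END's `ΘJ = 2 + (X + 2γ′) + (2(d₁ + (2d+d₁)ρℓγ′) + (2d+d₁)(ρℓX + Cr)) + 10` (census of record:
`ΘJ(13) ≈ 2.36·10²⁷`; `ΘJc(13) ≈ 6·10²` + the instance's `8·2^d·log(2d+1) ≈ 281` — numerals are leaf-08 g11's ∕
leaf-10 g12's files, none here).

WHAT.
* **`card_S_sortR_le_exp_pow'`** — THE CONCAVE TWIN END: for a pedigree `P` read «oldest line first» (`HeadOldest`) with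
  dated renewals (`RenewDated`) and forest ancestries (`Forest`), a component `cc` of step `≤ K` whose realised TAGGED
  member is `ConsistentTLE` (H1b), floors `≥ φ > 0` on the run, and the zone-side letters (`1 ≤ L`, `1 ≤ n`,
  `LevelFn K lv`, stride∕advance∕smallness∕decay) — the binders of `card_S_sortR_le_exp_pow` VERBATIM:
  `#S (zoneP …) ρ c₀ step (P.sortR.gen cc) z ≤ exp(ΘJc·bsum (fat+1) (P.gen cc) + (8∕φ)·totalCostT … (P.genT cc))
     · (L^d·e^4)^{partnerAges step (P.gen cc)}` for EVERY root datum `z`.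

HONEST SCOPE.  Composition over OUR carriers; displayed with named suppliers exactly as the twin END: `HeadOldest` ∕
`RenewDated` ∕ `Forest`, `ConsistentTLE` of the tagged member (H1b), the floor bound (flow), the zone-side side
conditions (symbolic); nothing of H3 ∕ (B) ∕ BetaPertH touched; the headline's Prop (p224237) is unchanged by this file
(only the hidden ∃-bound `g₁` moves once leaf-08 g11's (iii) re-homes the END at `Θ₀ := ΘJc`); NE7b NOT proved; spine
0∕9.  HONEST DEPENDENCY (cell): continuum YM on T⁴ ⇐ BetaPertH ∧ nine spine estimates (0/9 proved); BetaPertH ⇐ (D1) ∧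
(D4) ∧ CAP+tail; G-an2-4 gates asym, D1 and NE2/3/4.  This file changes none of it.
-/

open Finset
open Literature.MathematicalPhysics.QuantumFieldTheory.Balaban1983to89
open T4PersistenceDictionary T4PrintedShapeBanking T4TaggedShapeBanking T4PartnerMultiplicity T4BranchingRecordsGas
open Summit.QuantumFields.BalabanUV.T4Continuum.ZoneTorus
open Summit.QuantumFields.BalabanUV.T4Continuum.ZoneSkeleton
open Summit.QuantumFields.BalabanUV.T4Continuum.HistoryZones
open Summit.QuantumFields.BalabanUV.T4Continuum.HistoryZoneEvolve
open Summit.QuantumFields.BalabanUV.T4Continuum.HistoryZoneMassJoins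
open Summit.QuantumFields.BalabanUV.T4Continuum.HistoryZoneMassTotalFlat
open Summit.QuantumFields.BalabanUV.T4Continuum.HistoryBankingLE
open Summit.QuantumFields.BalabanUV.T4Continuum.HistoryJoins
open Summit.QuantumFields.BalabanUV.T4Continuum.HistoryJoinsAdm
open Summit.QuantumFields.BalabanUV.T4Continuum.HistoryJoinsBudget (mrg)
open Summit.QuantumFields.BalabanUV.T4Continuum.HistoryJoinsEntropyBudget (ENT)
open Summit.QuantumFields.BalabanUV.T4Continuum.HistoryJoinsEnd
open Summit.QuantumFields.BalabanUV.T4Continuum.HistoryGen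
open Summit.QuantumFields.BalabanUV.T4Continuum.HistorySiblingEntropyBridge
open Summit.QuantumFields.BalabanUV.T4Continuum.HistoryJoinsSortTwin
open Summit.QuantumFields.BalabanUV.T4Continuum.HistoryRegionTemplates
open Summit.QuantumFields.BalabanUV.T4Continuum.HistoryJoinsTemplates
open Summit.QuantumFields.BalabanUV.T4Continuum.HistoryJoinsPlacedZone
open Summit.QuantumFields.BalabanUV.T4Continuum.HistoryJoinsPlacedLaws
open Summit.QuantumFields.BalabanUV.T4Continuum.HistoryJoinsPlacedLawsConcave
open Summit.QuantumFields.BalabanUV.T4Continuum.HistoryJoinsPlacedTwin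

namespace Summit.QuantumFields.BalabanUV.T4Continuum.HistoryJoinsPlacedTwinConcave

noncomputable section

open scoped Classical

variable {α π : Type*} [DecidableEq α] [DecidableEq π] (P : Pedigree α π)

variable {d n L K D M : ℕ} {lv : ℕ → ℕ} {c : ℕ} {c₀ : TCell d (n * L ^ K) × Template d M}
  {R' : Type*} [LinearOrder R'] (ρ : (Addr D → TCell d (n * L ^ K) × Template d M) → R')

/-- **ROW S12o (ii) — THE CONCAVE TWIN END.**  For a pedigree `P` read «oldest line first» with dated renewals and
forest ancestries, a component `cc` of step `≤ K` whose realised tagged member is `ConsistentTLE` (H1b), floors `≥ φ > 0`,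
and the zone-side letters of file B2: for EVERY root datum `z`,
`#S (zoneP …) ρ c₀ step (P.sortR.gen cc) z ≤ exp(ΘJc·bsum (fat+1) (P.gen cc) + (8∕φ)·T)·(L^d·e^4)^{partnerAges}`
with the CONCAVE class-linear constant `ΘJc` of the module docstring (the class-linear letters of the REALISED flat member
`P.gen cc`, `T = totalCostT Prod.fst C K R (P.genT cc)`) — the binders of gen 4's `card_S_sortR_le_exp_pow` VERBATIM.
[folklore] -/
theorem card_S_sortR_le_exp_pow' (hH : ∀ c, P.HeadOldest c) (hR : P.RenewDated) (hF : ∀ c, P.Forest c)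
    {C : T4PrintedShapeBanking.Consts} {R : ℕ → ℕ} (hE₂ : 0 ≤ C.E₂) (hE₃ : 0 ≤ C.E₃) {φ : ℝ} (hφ0 : 0 < φ)
    (hφ : ∀ m, m ≤ K → φ ≤ floorK C K R m) (cc : α) (hc : ConsistentTLE Prod.fst C K R (P.genT cc))
    (hK : P.step cc ≤ K)
    (hL : 1 ≤ L) (hn : 1 ≤ n) (hlv : LevelFn K lv)
    {s m : ℕ} (hs : 1 ≤ s) (hm : ∀ u : ℕ, u + s ≤ K → lv u + m ≤ lv (u + s))
    (hsmall : (((2 * cth c 1 s + 1) ^ d : ℕ) : ℝ) * (5 : ℝ) ^ d * ((max 1 (2 * c + 2) : ℕ) : ℝ) ≤ (L : ℝ) ^ m / 2)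
    {θ : ℝ} (hθ0 : 0 ≤ θ) (hθ1 : θ < 1) (hθs : 1 / 2 ≤ θ ^ s)
    (z : TCell d (n * L ^ K) × Template d M) :
    ((S (zoneP n L K lv c c₀) ρ c₀ PEv.step (P.sortR.gen cc) z).card : ℝ) ≤
      Real.exp ((1 + Real.log
            ((2 * (((2 * cth c 1 s + 1) ^ d : ℕ) : ℝ) * ((((2 * c + 1) ^ d : ℕ) : ℝ) * (4 * 2 ^ d)) +
                  4 * ((((2 * cth c 1 s + 1) ^ d : ℕ) : ℝ) * (5 : ℝ) ^ d)) / (1 - θ) +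
              2 * (2 * ((((2 * cth c 1 s + 1) ^ d : ℕ) : ℝ) * (5 : ℝ) ^ d))) +
            (0 + 3 * (2 * Real.log (2 * d + 1)) + 2 * (d : ℝ) + 2 * Real.log (2 * d + 1) * (4 * 2 ^ d) +
              (d : ℝ) * Real.log (2 *
                ((((max 1 (2 * c + 2) : ℕ) : ℝ) *
                      ((2 * (((2 * cth c 1 s + 1) ^ d : ℕ) : ℝ) * ((((2 * c + 1) ^ d : ℕ) : ℝ) * (4 * 2 ^ d)) +
                          4 * ((((2 * cth c 1 s + 1) ^ d : ℕ) : ℝ) * (5 : ℝ) ^ d)) / (1 - θ)) +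
                    ((max 1 (2 * c + 2) : ℕ) : ℝ) * (2 * ((((2 * cth c 1 s + 1) ^ d : ℕ) : ℝ) * (5 : ℝ) ^ d)) + 1) *
                  (1 + 4 * 2 ^ d)) + 1)) +
            10) * bsum (fun b => ((b.fat : ℕ) : ℝ) + 1) (P.gen cc) + 8 / φ * totalCostT Prod.fst C K R (P.genT cc)) *
        (((L : ℝ) ^ d) * Real.exp 4) ^ partnerAges PEv.step (P.gen cc) := by
  have hDt : Dated PEv.step true (P.step cc + 1) (P.sortR.gen cc) :=
    dated_gen (P := P.sortR) (headOldest_sortR P hH) cc (Nat.lt_succ_self _)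
  have hCh : Chrono PEv.step (P.sortR.gen cc) := chronoZ_gen (P := P.sortR) (headOldest_sortR P hH) cc
  have h := card_S_le_exp_pow_zonePΩ (c := c) (c₀ := c₀) ρ hL hn hlv hDt (by omega) hCh hs hm hsmall hθ0 hθ1 hθs
    (hENT_sortR P hH hR hF hE₂ hE₃ hφ0 hφ cc hc) z
  rw [bsum_gen_sortR P _ hH cc, partnerAges_gen_sortR P hH cc] at h
  exact h

/-- **NO LOSS**: the concave twin END's binders ARE the twin END's — both conclusions available from one hypothesis list
(a consumer may quote either constant). [folklore] -/
example (hH : ∀ c, P.HeadOldest c) (hR : P.RenewDated) (hF : ∀ c, P.Forest c)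
    {C : T4PrintedShapeBanking.Consts} {R : ℕ → ℕ} (hE₂ : 0 ≤ C.E₂) (hE₃ : 0 ≤ C.E₃) {φ : ℝ} (hφ0 : 0 < φ)
    (hφ : ∀ m, m ≤ K → φ ≤ floorK C K R m) (cc : α) (hc : ConsistentTLE Prod.fst C K R (P.genT cc))
    (hK : P.step cc ≤ K)
    (hL : 1 ≤ L) (hn : 1 ≤ n) (hlv : LevelFn K lv)
    {s m : ℕ} (hs : 1 ≤ s) (hm : ∀ u : ℕ, u + s ≤ K → lv u + m ≤ lv (u + s))
    (hsmall : (((2 * cth c 1 s + 1) ^ d : ℕ) : ℝ) * (5 : ℝ) ^ d * ((max 1 (2 * c + 2) : ℕ) : ℝ) ≤ (L : ℝ) ^ m / 2)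
    {θ : ℝ} (hθ0 : 0 ≤ θ) (hθ1 : θ < 1) (hθs : 1 / 2 ≤ θ ^ s)
    (z : TCell d (n * L ^ K) × Template d M) :=
  And.intro
    (card_S_sortR_le_exp_pow (c := c) (c₀ := c₀) P ρ hH hR hF hE₂ hE₃ hφ0 hφ cc hc hK hL hn hlv hs hm hsmall hθ0 hθ1 hθs z)
    (card_S_sortR_le_exp_pow' (c := c) (c₀ := c₀) P ρ hH hR hF hE₂ hE₃ hφ0 hφ cc hc hK hL hn hlv hs hm hsmall hθ0 hθ1
      hθs z)

end

end Summit.QuantumFields.BalabanUV.T4Continuum.HistoryJoinsPlacedTwinConcave
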